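import Summits.Ventures.HodgeRepro2.T5QuadraticConductor

/-!
# T5QuadraticSplitRamified — the split and ramified sides of the quadratic Kummer–Dedekind census

Tier-5 kernel support (seat p8, blind lane; sub-step N3, the census of the datum's places).
T5-172 … T5-174 characterised the INERT places of `L = K(√d)` by «`d` is a non-square mod `v`».
This file adds the other two branches of Dedekind–Kummer on `X² − d`, in Mathlib's abstract
setting (`R ⊆ S`, `minpoly R x = X² − d`, `I` maximal coprime to the conductor of `R[x]`) and on
number fields:

* SPLIT — `d ≡ a² (mod I)` with `a, 2 ∉ I`: `X² − d̄ = (X − ā)(X + ā)` has two distinct monic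
  irreducible factors, and Mathlib's factor bijection
  `KummerDedekind.normalizedFactorsMapEquivNormalizedFactorsMinPolyMk` returns two DISTINCT primes
  of `S` over `I` (`exists_two_primes_of_sq_eq`); on number fields, for `4d ∉ v` and `d` a square
  mod `v`, two distinct finite places `w₁ ≠ w₂` of `L` over `v` (`exists_ne_liesOver_of_isSquare`)
  — the places of N3.10.2 (T5-161);
* RAMIFIED — `d ∈ I`: `X² − d̄ = X²`, the unique factor `X` has multiplicity `2`, so the prime of
  `S` over `I` has ramification index `2` (`exists_ramificationIdx_eq_two_of_mem`; on number
  fields `exists_ramificationIdx'_eq_two_of_mem`) — the places of `S_bad`;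
* the DICHOTOMY at `4d ∉ v`: `v` splits or stays prime according as `d` is or is not a square
  mod `v` (`split_or_staysPrime`, `staysPrime_iff_not_isSquare`).

No `sorry`, no axiom beyond `propext`, `Classical.choice`, `Quot.sound`.
-/

namespace Summit.Ventures.HodgeRepro2.T5QuadraticSplitRamified

open Polynomial UniqueFactorizationMonoid

section Abstract

variable {R S : Type*} [CommRing R] [CommRing S] [Algebra R S] [IsDomain R] [IsIntegrallyClosed R]
  [IsDedekindDomain S] [Module.IsTorsionFree R S] {x : S} {I : Ideal R} {d : R}

omit [IsDomain R] [IsIntegrallyClosed R] [IsDedekindDomain S] [Module.IsTorsionFree R S] in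
/-- The reduction of `X ^ 2 - C d` modulo `I` factors as `(X - C ā) (X + C ā)` when `a * a ≡ d`. -/
theorem map_minpoly_eq_mul (hmin : minpoly R x = X ^ 2 - C d) {a : R}
    (ha : Ideal.Quotient.mk I (a * a) = Ideal.Quotient.mk I d) :
    (minpoly R x).map (Ideal.Quotient.mk I) =
      (X - C (Ideal.Quotient.mk I a)) * (X + C (Ideal.Quotient.mk I a)) := by
  rw [T5QuadraticKummerDedekind.map_minpoly_eq hmin, ← ha, map_mul, C_mul]
  ring

omit [IsDomain R] [IsIntegrallyClosed R] [IsDedekindDomain S] [Module.IsTorsionFree R S] in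
/-- `X - C ā ≠ X + C ā` when `2 ∉ I` and `a ∉ I` (compare the constant coefficients). -/
theorem X_sub_C_ne_X_add_C (hI : I.IsMaximal) (h2 : (2 : R) ∉ I) {a : R} (ha : a ∉ I) :
    (X - C (Ideal.Quotient.mk I a) : (R ⧸ I)[X]) ≠ X + C (Ideal.Quotient.mk I a) := by
  intro h
  have hc := congrArg (fun p : (R ⧸ I)[X] => p.coeff 0) h
  simp only [coeff_sub, coeff_add, coeff_X_zero, coeff_C_zero, zero_sub, zero_add] at hc
  -- `-ā = ā`, so `2 ā = 0` in the field `R ⧸ I`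
  have h2a : Ideal.Quotient.mk I (2 * a) = 0 := by
    rw [map_mul]
    have : (2 : R ⧸ I) * Ideal.Quotient.mk I a = Ideal.Quotient.mk I a + Ideal.Quotient.mk I a := by
      ring
    rw [map_ofNat, this]
    nth_rewrite 1 [← hc]
    ring
  rw [Ideal.Quotient.eq_zero_iff_mem] at h2a
  exact (hI.isPrime.mem_or_mem h2a).elim h2 ha

/-- **Kummer–Dedekind, quadratic case, split direction**: if `d ≡ a * a (mod I)` with `a ∉ I`
and `2 ∉ I`, then there are two DISTINCT prime ideals of `S` containing `I S`. -/
theorem exists_two_primes_of_sq_eq (hI : I.IsMaximal) (hI' : I ≠ ⊥)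
    (hx : (conductor R x).comap (algebraMap R S) ⊔ I = ⊤) (hx' : IsIntegral R x)
    (hmin : minpoly R x = X ^ 2 - C d) (h2 : (2 : R) ∉ I) {a : R} (ha : a ∉ I)
    (hsq : Ideal.Quotient.mk I (a * a) = Ideal.Quotient.mk I d) :
    ∃ J₁ J₂ : Ideal S, J₁.IsPrime ∧ J₂.IsPrime ∧ J₁ ≠ J₂ ∧
      I.map (algebraMap R S) ≤ J₁ ∧ I.map (algebraMap R S) ≤ J₂ := by
  classical
  haveI : I.IsMaximal := hI
  letI := Ideal.Quotient.field I
  have hf := map_minpoly_eq_mul (I := I) hmin hsq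
  have hne := X_sub_C_ne_X_add_C hI h2 ha
  have hirr₁ : Irreducible (X - C (Ideal.Quotient.mk I a) : (R ⧸ I)[X]) := irreducible_X_sub_C _
  have hirr₂ : Irreducible (X + C (Ideal.Quotient.mk I a) : (R ⧸ I)[X]) := by
    have : (X + C (Ideal.Quotient.mk I a) : (R ⧸ I)[X]) = X - C (-(Ideal.Quotient.mk I a)) := by
      rw [map_neg, sub_neg_eq_add]
    rw [this]
    exact irreducible_X_sub_C _
  have hnf : normalizedFactors ((minpoly R x).map (Ideal.Quotient.mk I)) =
      {X - C (Ideal.Quotient.mk I a), X + C (Ideal.Quotient.mk I a)} := by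
    rw [hf, normalizedFactors_mul hirr₁.ne_zero hirr₂.ne_zero, normalizedFactors_irreducible hirr₁,
      normalizedFactors_irreducible hirr₂, (monic_X_sub_C _).normalize_eq_self,
      (monic_X_add_C _).normalize_eq_self]
    rfl
  have hmem₁ : (X - C (Ideal.Quotient.mk I a) : (R ⧸ I)[X]) ∈
      normalizedFactors ((minpoly R x).map (Ideal.Quotient.mk I)) := by
    rw [hnf]; simp
  have hmem₂ : (X + C (Ideal.Quotient.mk I a) : (R ⧸ I)[X]) ∈
      normalizedFactors ((minpoly R x).map (Ideal.Quotient.mk I)) := by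
    rw [hnf]; simp
  let e := KummerDedekind.normalizedFactorsMapEquivNormalizedFactorsMinPolyMk hI hI' hx hx'
  have hmapne : I.map (algebraMap R S) ≠ 0 := T5QuadraticKummerDedekind.map_ne_bot hI'
  have hprime : ∀ J ∈ normalizedFactors (I.map (algebraMap R S)), J.IsPrime := fun J hJ =>
    (Ideal.prime_iff_isPrime (irreducible_of_normalized_factor J hJ).ne_zero).mp
      (irreducible_iff_prime.mp (irreducible_of_normalized_factor J hJ))
  refine ⟨(e.symm ⟨_, hmem₁⟩).1, (e.symm ⟨_, hmem₂⟩).1, hprime _ (e.symm ⟨_, hmem₁⟩).2,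
    hprime _ (e.symm ⟨_, hmem₂⟩).2, ?_, ?_, ?_⟩
  · intro h
    have h' := e.symm.injective (Subtype.ext h)
    exact hne (congrArg Subtype.val h')
  · exact Ideal.le_of_dvd (dvd_of_mem_normalizedFactors (e.symm ⟨_, hmem₁⟩).2)
  · exact Ideal.le_of_dvd (dvd_of_mem_normalizedFactors (e.symm ⟨_, hmem₂⟩).2)

omit [IsDomain R] [IsIntegrallyClosed R] [IsDedekindDomain S] [Module.IsTorsionFree R S] in
/-- The reduction of `X ^ 2 - C d` modulo `I` is `X ^ 2` when `d ∈ I`. -/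
theorem map_minpoly_eq_X_sq (hmin : minpoly R x = X ^ 2 - C d) (hd : d ∈ I) :
    (minpoly R x).map (Ideal.Quotient.mk I) = X ^ 2 := by
  rw [T5QuadraticKummerDedekind.map_minpoly_eq hmin, Ideal.Quotient.eq_zero_iff_mem.mpr hd, map_zero,
    sub_zero]

/-- **Kummer–Dedekind, quadratic case, ramified direction**: if `d ∈ I` then some prime `J` of `S`
over `I` has ramification index `2` (the factor `X` of `X ^ 2` has multiplicity `2`). -/
theorem exists_ramificationIdx_eq_two_of_mem (hI : I.IsMaximal) (hI' : I ≠ ⊥)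
    (hx : (conductor R x).comap (algebraMap R S) ⊔ I = ⊤) (hx' : IsIntegral R x)
    (hmin : minpoly R x = X ^ 2 - C d) (hd : d ∈ I) :
    ∃ J : Ideal S, J.IsPrime ∧ I.map (algebraMap R S) ≤ J ∧
      Multiset.count J (normalizedFactors (I.map (algebraMap R S))) = 2 := by
  classical
  haveI : I.IsMaximal := hI
  letI := Ideal.Quotient.field I
  have hf := map_minpoly_eq_X_sq (I := I) hmin hd
  have hnf : normalizedFactors ((minpoly R x).map (Ideal.Quotient.mk I)) = 2 • {(X : (R ⧸ I)[X])} := by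
    rw [hf, normalizedFactors_pow, normalizedFactors_irreducible (irreducible_X (R := R ⧸ I)),
      (monic_X (R := R ⧸ I)).normalize_eq_self]
  have hmem : (X : (R ⧸ I)[X]) ∈ normalizedFactors ((minpoly R x).map (Ideal.Quotient.mk I)) := by
    rw [hnf]; simp
  let e := KummerDedekind.normalizedFactorsMapEquivNormalizedFactorsMinPolyMk hI hI' hx hx'
  have hmapne : I.map (algebraMap R S) ≠ 0 := T5QuadraticKummerDedekind.map_ne_bot hI'
  have hJ := (e.symm ⟨_, hmem⟩).2
  have hJirr := irreducible_of_normalized_factor _ hJ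
  refine ⟨(e.symm ⟨_, hmem⟩).1,
    (Ideal.prime_iff_isPrime hJirr.ne_zero).mp (irreducible_iff_prime.mp hJirr),
    Ideal.le_of_dvd (dvd_of_mem_normalizedFactors hJ), ?_⟩
  have hmult := KummerDedekind.emultiplicity_factors_map_eq_emultiplicity hI hI' hx hx' hJ
  rw [Equiv.apply_symm_apply] at hmult
  have hcX : Multiset.count (X : (R ⧸ I)[X])
      (normalizedFactors ((minpoly R x).map (Ideal.Quotient.mk I))) = 2 := by
    rw [hnf, Multiset.count_nsmul, Multiset.count_singleton_self, mul_one]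
  rw [emultiplicity_eq_count_normalizedFactors hJirr hmapne, normalize_eq,
    emultiplicity_eq_count_normalizedFactors (irreducible_X (R := R ⧸ I))
      (Polynomial.map_monic_ne_zero (minpoly.monic hx')), (monic_X (R := R ⧸ I)).normalize_eq_self,
    hcX] at hmult
  exact_mod_cast hmult

end Abstract

section NumberField

open NumberField IsDedekindDomain HeightOneSpectrum

variable {K : Type*} [Field K] [NumberField K] {L : Type*} [Field L] [NumberField L] [Algebra K L]
  {x : 𝓞 L} {d : 𝓞 K} (v : HeightOneSpectrum (𝓞 K))

omit [NumberField L] in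
/-- A prime `J` of `𝓞 L` containing `v 𝓞_L` lies over `v`. -/
theorem liesOver_of_map_le {J : Ideal (𝓞 L)} [hJ : J.IsPrime]
    (hle : v.asIdeal.map (algebraMap (𝓞 K) (𝓞 L)) ≤ J) : J.LiesOver v.asIdeal := by
  rw [Ideal.liesOver_iff, Ideal.under_def]
  refine v.isMaximal.eq_of_le ?_ (Ideal.map_le_iff_le_comap.mp hle)
  exact (Ideal.IsPrime.comap (algebraMap (𝓞 K) (𝓞 L)) (K := J)).ne_top

/-- **SPLIT**: for `4d ∉ v` and `d` a square modulo `v`, there are two distinct finite places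
`w₁ ≠ w₂` of `L` over `v` (`x² = d`, `x ∉ 𝓞_K`, `[L : K] = 2`). -/
theorem exists_ne_liesOver_of_isSquare (h2 : Module.finrank K L = 2)
    (hx : x * x = algebraMap (𝓞 K) (𝓞 L) d) (hx' : x ∉ Set.range (algebraMap (𝓞 K) (𝓞 L)))
    (hv : 4 * d ∉ v.asIdeal) (hd : IsSquare (Ideal.Quotient.mk v.asIdeal d)) :
    ∃ w₁ w₂ : HeightOneSpectrum (𝓞 L), w₁ ≠ w₂ ∧
      w₁.asIdeal.LiesOver v.asIdeal ∧ w₂.asIdeal.LiesOver v.asIdeal := by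
  have hmin := T5QuadraticInertCriterion.minpoly_eq_X_sq_sub_C hx hx'
  have hcond := T5QuadraticConductor.comap_conductor_sup_eq_top h2 hx hmin v hv
  have h2v : (2 : 𝓞 K) ∉ v.asIdeal := fun h => hv (by
    have : (4 : 𝓞 K) * d = 2 * (2 * d) := by ring
    rw [this]; exact Ideal.mul_mem_right _ _ h)
  have hdv : d ∉ v.asIdeal := fun h => hv (Ideal.mul_mem_left _ _ h)
  obtain ⟨b, hb⟩ := hd
  obtain ⟨a, rfl⟩ := Ideal.Quotient.mk_surjective b
  have hsq : Ideal.Quotient.mk v.asIdeal (a * a) = Ideal.Quotient.mk v.asIdeal d := by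
    rw [map_mul, hb]
  have hav : a ∉ v.asIdeal := fun h => hdv (by
    have : Ideal.Quotient.mk v.asIdeal d = 0 := by
      rw [← hsq, map_mul, Ideal.Quotient.eq_zero_iff_mem.mpr h, zero_mul]
    exact Ideal.Quotient.eq_zero_iff_mem.mp this)
  obtain ⟨J₁, J₂, hJ₁, hJ₂, hne, hle₁, hle₂⟩ :=
    exists_two_primes_of_sq_eq v.isMaximal v.ne_bot hcond (Algebra.IsIntegral.isIntegral x) hmin
      h2v hav hsq
  have hne₁ : J₁ ≠ ⊥ := fun h => by
    have := T5QuadraticKummerDedekind.map_ne_bot (S := 𝓞 L) v.ne_bot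
    exact this (le_bot_iff.mp (h ▸ hle₁))
  have hne₂ : J₂ ≠ ⊥ := fun h => by
    have := T5QuadraticKummerDedekind.map_ne_bot (S := 𝓞 L) v.ne_bot
    exact this (le_bot_iff.mp (h ▸ hle₂))
  haveI := hJ₁
  haveI := hJ₂
  exact ⟨⟨J₁, hJ₁, hne₁⟩, ⟨J₂, hJ₂, hne₂⟩, fun h => hne (congrArg HeightOneSpectrum.asIdeal h),
    liesOver_of_map_le v hle₁, liesOver_of_map_le v hle₂⟩

/-- **RAMIFIED**: for `d ∈ v` (and `v` coprime to the conductor of `𝓞_K[x]`) some finite place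
`w` of `L` over `v` has `e(w/v) = 2`. -/
theorem exists_ramificationIdx'_eq_two_of_mem
    (hcond : (conductor (𝓞 K) x).comap (algebraMap (𝓞 K) (𝓞 L)) ⊔ v.asIdeal = ⊤)
    (hmin : minpoly (𝓞 K) x = X ^ 2 - C d) (hd : d ∈ v.asIdeal) :
    ∃ w : HeightOneSpectrum (𝓞 L), w.asIdeal.LiesOver v.asIdeal ∧
      v.asIdeal.ramificationIdx' w.asIdeal = 2 := by
  classical
  obtain ⟨J, hJ, hle, hcount⟩ :=
    exists_ramificationIdx_eq_two_of_mem v.isMaximal v.ne_bot hcond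
      (Algebra.IsIntegral.isIntegral x) hmin hd
  have hneJ : J ≠ ⊥ := fun h => by
    have := T5QuadraticKummerDedekind.map_ne_bot (S := 𝓞 L) v.ne_bot
    exact this (le_bot_iff.mp (h ▸ hle))
  haveI := hJ
  haveI hlo : J.LiesOver v.asIdeal := liesOver_of_map_le v hle
  refine ⟨⟨J, hJ, hneJ⟩, hlo, ?_⟩
  change v.asIdeal.ramificationIdx' J = 2
  rw [Ideal.ramificationIdx'_eq_ramificationIdx v.asIdeal J v.ne_bot,
    Ideal.IsDedekindDomain.ramificationIdx_eq_normalizedFactors_count v.asIdeal J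
      (T5QuadraticKummerDedekind.map_ne_bot v.ne_bot)]
  exact hcount

/-- **THE DICHOTOMY at `4d ∉ v`**: `v` splits in `L = K(√d)` (two distinct places over it) or stays
prime (`v 𝓞_L = w`), according as `d` is or is not a square modulo `v`. -/
theorem split_or_staysPrime (h2 : Module.finrank K L = 2)
    (hx : x * x = algebraMap (𝓞 K) (𝓞 L) d) (hx' : x ∉ Set.range (algebraMap (𝓞 K) (𝓞 L)))
    (hv : 4 * d ∉ v.asIdeal) :
    (IsSquare (Ideal.Quotient.mk v.asIdeal d) ∧ ∃ w₁ w₂ : HeightOneSpectrum (𝓞 L), w₁ ≠ w₂ ∧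
        w₁.asIdeal.LiesOver v.asIdeal ∧ w₂.asIdeal.LiesOver v.asIdeal) ∨
      (¬ IsSquare (Ideal.Quotient.mk v.asIdeal d) ∧ ∃ w : HeightOneSpectrum (𝓞 L),
        v.asIdeal.map (algebraMap (𝓞 K) (𝓞 L)) = w.asIdeal) := by
  by_cases hd : IsSquare (Ideal.Quotient.mk v.asIdeal d)
  · exact Or.inl ⟨hd, exists_ne_liesOver_of_isSquare v h2 hx hx' hv hd⟩
  · exact Or.inr ⟨hd,
      (T5QuadraticConductor.exists_map_eq_asIdeal_iff_not_isSquare v h2 hx hx' hv).mpr hd⟩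

end NumberField

end Summit.Ventures.HodgeRepro2.T5QuadraticSplitRamified
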